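import Summits.Ventures.Crystal3D.Theorems.StickyWulffConstantNoReconstructionGainLatticeAdhesion
import HarnessLib

/-!
# The core reduction of the adhesion atom: only strictly positive-gain films (7-cores) matter

HONEST FRAMING. Part of the venture `Summits/Ventures/Crystal3D` (cell `crystal3d-full`), helper
`--supports` the crux `NoReconstructionGain` (stmt-Ventures-19144, route
`route-Ventures-StickyWulffConstant`), line `adhesion` (wulff-p1 g11).  A standard minimal-
counterexample reduction, made kernel-exact for the atom `#cross(P, X∖P) ≤ D(X∖P) + Cρ`:

* `cross_le_of_removable` — ONE PEELING STEP: if a set `S` of film balls receives from the rest of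
  the packing no more bonds than its own deficiency, `#cross(X∖S, S) ≤ D(S)` (equivalently
  `E(S) + E(S, X∖S) ≤ 6·#S`: deleting `S` does not lower the gain), then the atom's inequality for
  the peeled packing `X∖S ⊇ P` implies it for `X` (same constant);
* `cross_le_of_core` — hence, for any class of packings closed under deleting film balls, the
  atom's inequality holds for the whole class as soon as it holds for its CORES: the packings in
  which EVERY nonempty set `S` of film balls is bound strictly better than free,
  `D(S) < #cross(X∖S, S)`;
* `seven_le_card_partners_of_core` — in a core every film ball has at least `7` contacts;
* `adhesion_of_core`, `adhesion_of_core_slab`, `adhesion_of_sevenCore`, `adhesion_of_sevenCore_slab`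
  (**rungs**, registered by name on stmt-Ventures-19144): the atom (plain form / slab form with the
  film above the cut) follows from its restriction to cores, resp. to films all of whose balls have
  `≥ 7` contacts — with the SAME `R` and `C`.

So a counterexample to the crux may be sought (census engines) and must be excluded (proofs) only
among 7-cores glued to the slab sample whose every sub-film gains strictly; in particular the
`ν`-highest film ball of a core has `≥ 7` contacts in a closed lower half-space.

WHAT THIS IS NOT: no bound on cores themselves — that is the crux; rung F-C1 not moved.
-/

noncomputable section

namespace Summit.Ventures.Crystal3D.Theorems

open Summit.Ventures.Crystal3D Finset
open Literature.MathematicalPhysics.StatisticalMechanics (fccStacking orderedContacts contactDeficiency)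
open scoped InnerProductSpace

/-! ## Cross-contact bookkeeping -/

/-- The deficiency of a single ball is `6`. -/
theorem contactDeficiency_singleton (q : EuclideanSpace ℝ (Fin 3)) :
    contactDeficiency ({q} : Finset (EuclideanSpace ℝ (Fin 3))) = 6 := by
  classical
  unfold contactDeficiency orderedContacts
  have h0 : ((({q} : Finset (EuclideanSpace ℝ (Fin 3))) ×ˢ ({q} : Finset (EuclideanSpace ℝ (Fin 3)))).filter
      fun pq => dist pq.1 pq.2 = 1).card = 0 := by
    rw [card_eq_zero, filter_eq_empty_iff]
    intro pq hpq
    rw [mem_product, mem_singleton, mem_singleton] at hpq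
    rw [hpq.1, hpq.2, dist_self]; norm_num
  rw [h0, card_singleton]; norm_num

/-- The bonds a single film ball `q` receives from the rest of the packing are its contacts. -/
theorem card_cross_sdiff_singleton (X : Finset (EuclideanSpace ℝ (Fin 3))) (q : EuclideanSpace ℝ (Fin 3)) :
    (((X \ {q}) ×ˢ ({q} : Finset (EuclideanSpace ℝ (Fin 3)))).filter fun pq => dist pq.1 pq.2 = 1).card =
      (X.filter fun x => dist q x = 1).card := by
  classical
  refine card_bij (fun pq _ => pq.1) ?_ ?_ ?_
  · intro pq hpq
    simp only [mem_filter, mem_product, mem_sdiff, mem_singleton] at hpq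
    refine mem_filter.2 ⟨hpq.1.1.1, ?_⟩
    rw [dist_comm, ← hpq.1.2]; exact hpq.2
  · intro pq hpq pq' hpq' h
    simp only [mem_filter, mem_product, mem_singleton] at hpq hpq'
    exact Prod.ext h (by rw [hpq.1.2, hpq'.1.2])
  · intro x hx
    rw [mem_filter] at hx
    have hxq : x ≠ q := by
      intro hxq
      rw [hxq, dist_self] at hx; norm_num at hx
    refine ⟨(x, q), ?_, rfl⟩
    refine mem_filter.2 ⟨mem_product.2 ⟨mem_sdiff.2 ⟨hx.1, ?_⟩, mem_singleton_self q⟩, ?_⟩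
    · rwa [mem_singleton]
    · show dist x q = 1
      rw [dist_comm]; exact hx.2

/-! ## One peeling step -/

/-- **One peeling step.**  `P ⊆ X`, `S ⊆ X ∖ P` a set of film balls bound no better than free,
`#cross(X∖S, S) ≤ D(S)`; then the atom's inequality for `X ∖ S ⊇ P` (constant `c`) gives it for
`X`. -/
theorem cross_le_of_removable (X P S : Finset (EuclideanSpace ℝ (Fin 3))) (hPX : P ⊆ X)
    (hS : S ⊆ X \ P) (c : ℝ)
    (hrem : (((((X \ S) ×ˢ S).filter fun pq => dist pq.1 pq.2 = 1).card : ℕ) : ℝ) ≤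
      contactDeficiency S)
    (hIH : ((((P ×ˢ ((X \ S) \ P)).filter fun pq => dist pq.1 pq.2 = 1).card : ℕ) : ℝ) ≤
      contactDeficiency ((X \ S) \ P) + c) :
    ((((P ×ˢ (X \ P)).filter fun pq => dist pq.1 pq.2 = 1).card : ℕ) : ℝ) ≤
      contactDeficiency (X \ P) + c := by
  classical
  set F := X \ P with hF
  have hSF : S ⊆ F := hS
  have hXS : (X \ S) \ P = F \ S := by
    ext x; simp only [hF, mem_sdiff]; tauto
  rw [hXS] at hIH
  -- `F = (F ∖ S) ∪ S`
  have hdisj : Disjoint (F \ S) S := sdiff_disjoint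
  have hFun : F = (F \ S) ∪ S := (sdiff_union_of_subset hSF).symm
  have hcrossF : ((P ×ˢ F).filter fun pq => dist pq.1 pq.2 = 1).card =
      ((P ×ˢ (F \ S)).filter fun pq => dist pq.1 pq.2 = 1).card +
        ((P ×ˢ S).filter fun pq => dist pq.1 pq.2 = 1).card := by
    conv_lhs => rw [hFun]
    rw [product_union, filter_union, card_union_of_disjoint]
    exact disjoint_filter_filter (disjoint_product.2 (Or.inr hdisj))
  -- `D(F) = D(F ∖ S) + D(S) − #cross(F ∖ S, S)`
  have hsplit := contactDeficiency_sdiff_split (sdiff_subset : F \ S ⊆ F)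
  rw [Finset.sdiff_sdiff_eq_self hSF] at hsplit
  -- `X ∖ S = P ∪ (F ∖ S)`
  have hPS : Disjoint P (F \ S) := by
    rw [hF]; exact disjoint_sdiff.mono_right sdiff_subset
  have hXSun : X \ S = P ∪ (F \ S) := by
    ext x; simp only [hF, mem_sdiff, mem_union]
    constructor
    · intro hx
      by_cases hxP : x ∈ P
      · exact Or.inl hxP
      · exact Or.inr ⟨⟨hx.1, hxP⟩, hx.2⟩
    · rintro (hxP | hx)
      · exact ⟨hPX hxP, fun hxS => (mem_sdiff.1 (hS hxS)).2 hxP⟩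
      · exact ⟨hx.1.1, hx.2⟩
  have hcrossS : (((X \ S) ×ˢ S).filter fun pq => dist pq.1 pq.2 = 1).card =
      ((P ×ˢ S).filter fun pq => dist pq.1 pq.2 = 1).card +
        (((F \ S) ×ˢ S).filter fun pq => dist pq.1 pq.2 = 1).card := by
    rw [hXSun, union_product, filter_union, card_union_of_disjoint]
    exact disjoint_filter_filter (disjoint_product.2 (Or.inl hPS))
  rw [hcrossS] at hrem
  rw [hcrossF]
  push_cast at hrem hIH ⊢
  linarith

/-! ## Cores -/

/-- **The core reduction, abstract form.**  `Good` a property of packings closed under deleting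
film balls (balls off `P`).  If the atom's inequality with constant `c` holds for every `Good`
packing `X ⊇ P` that is a CORE — every nonempty `S ⊆ X ∖ P` has `D(S) < #cross(X∖S, S)` — then it
holds for every `Good` packing `X ⊇ P`. -/
theorem cross_le_of_core (P : Finset (EuclideanSpace ℝ (Fin 3))) (c : ℝ)
    (Good : Finset (EuclideanSpace ℝ (Fin 3)) → Prop)
    (hGood : ∀ X S, Good X → S ⊆ X \ P → Good (X \ S))
    (hcore : ∀ X, Good X → P ⊆ X →
      (∀ S, S ⊆ X \ P → S.Nonempty →
        contactDeficiency S < (((((X \ S) ×ˢ S).filter fun pq => dist pq.1 pq.2 = 1).card : ℕ) : ℝ)) →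
      ((((P ×ˢ (X \ P)).filter fun pq => dist pq.1 pq.2 = 1).card : ℕ) : ℝ) ≤
        contactDeficiency (X \ P) + c) :
    ∀ X, Good X → P ⊆ X →
      ((((P ×ˢ (X \ P)).filter fun pq => dist pq.1 pq.2 = 1).card : ℕ) : ℝ) ≤
        contactDeficiency (X \ P) + c := by
  classical
  intro X
  refine Finset.strongInduction (p := fun X => Good X → P ⊆ X →
      ((((P ×ˢ (X \ P)).filter fun pq => dist pq.1 pq.2 = 1).card : ℕ) : ℝ) ≤
        contactDeficiency (X \ P) + c) (fun X ih => ?_) X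
  intro hG hPX
  by_cases hc : ∀ S, S ⊆ X \ P → S.Nonempty →
      contactDeficiency S < (((((X \ S) ×ˢ S).filter fun pq => dist pq.1 pq.2 = 1).card : ℕ) : ℝ)
  · exact hcore X hG hPX hc
  · push Not at hc
    obtain ⟨S, hS, hSne, hrem⟩ := hc
    have hlt : X \ S ⊂ X := by
      obtain ⟨q, hq⟩ := hSne
      exact ⟨sdiff_subset, fun h => (mem_sdiff.1 (h (mem_sdiff.1 (hS hq)).1)).2 hq⟩
    have hPXS : P ⊆ X \ S := fun p hp =>
      mem_sdiff.2 ⟨hPX hp, fun hpS => (mem_sdiff.1 (hS hpS)).2 hp⟩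
    have hIH := ih (X \ S) hlt (hGood X S hG hS) hPXS
    exact cross_le_of_removable X P S hPX hS c hrem hIH

/-- **In a core every film ball has at least seven contacts.** -/
theorem seven_le_card_partners_of_core (X P : Finset (EuclideanSpace ℝ (Fin 3)))
    (hcore : ∀ S, S ⊆ X \ P → S.Nonempty →
      contactDeficiency S < (((((X \ S) ×ˢ S).filter fun pq => dist pq.1 pq.2 = 1).card : ℕ) : ℝ))
    (q : EuclideanSpace ℝ (Fin 3)) (hq : q ∈ X \ P) :
    7 ≤ (X.filter fun x => dist q x = 1).card := by
  classical
  have h := hcore {q} (singleton_subset_iff.2 hq) (singleton_nonempty q)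
  rw [contactDeficiency_singleton, card_cross_sdiff_singleton] at h
  have h7 : (6 : ℝ) < ((X.filter fun x => dist q x = 1).card : ℝ) := by exact_mod_cast h
  exact_mod_cast (show (7 : ℝ) ≤ (X.filter fun x => dist q x = 1).card by
    have := Nat.lt_iff_add_one_le.1 (show 6 < (X.filter fun x => dist q x = 1).card by exact_mod_cast h7)
    exact_mod_cast this)

/-! ## The rungs: the atom from its restriction to cores / to 7-cores -/

/-- **The atom follows from its restriction to cores** (same `R`, `C`; registered by name on
stmt-Ventures-19144). -/
theorem adhesion_of_core
    (h : ∃ R C : ℝ, 1 ≤ R ∧ ∀ ν : EuclideanSpace ℝ (Fin 3), ‖ν‖ = 1 → ∀ ρ : ℝ, R ≤ ρ →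
      ∀ X P : Finset (EuclideanSpace ℝ (Fin 3)),
      (∀ p ∈ X, ∀ q ∈ X, p ≠ q → 1 ≤ dist p q) → P ⊆ X →
      (∀ p, p ∈ P ↔ (p ∈ fccStacking 1 (Real.sqrt (2 / 3)) ∧ -(2 * R) ≤ ⟪p, ν⟫_ℝ ∧
        ⟪p, ν⟫_ℝ ≤ -R ∧ ‖p‖ ^ 2 - ⟪p, ν⟫_ℝ ^ 2 ≤ ρ ^ 2)) →
      (∀ S, S ⊆ X \ P → S.Nonempty →
        contactDeficiency S < (((((X \ S) ×ˢ S).filter fun pq => dist pq.1 pq.2 = 1).card : ℕ) : ℝ)) →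
      ((((P ×ˢ (X \ P)).filter fun pq => dist pq.1 pq.2 = 1).card : ℕ) : ℝ) ≤
        contactDeficiency (X \ P) + C * ρ) :
    ∃ R C : ℝ, 1 ≤ R ∧ ∀ ν : EuclideanSpace ℝ (Fin 3), ‖ν‖ = 1 → ∀ ρ : ℝ, R ≤ ρ →
      ∀ X P : Finset (EuclideanSpace ℝ (Fin 3)),
      (∀ p ∈ X, ∀ q ∈ X, p ≠ q → 1 ≤ dist p q) → P ⊆ X →
      (∀ p, p ∈ P ↔ (p ∈ fccStacking 1 (Real.sqrt (2 / 3)) ∧ -(2 * R) ≤ ⟪p, ν⟫_ℝ ∧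
        ⟪p, ν⟫_ℝ ≤ -R ∧ ‖p‖ ^ 2 - ⟪p, ν⟫_ℝ ^ 2 ≤ ρ ^ 2)) →
      ((((P ×ˢ (X \ P)).filter fun pq => dist pq.1 pq.2 = 1).card : ℕ) : ℝ) ≤
        contactDeficiency (X \ P) + C * ρ := by
  classical
  obtain ⟨R, C, hR, h⟩ := h
  refine ⟨R, C, hR, ?_⟩
  intro ν hν ρ hρ X P hX hPX hP
  refine cross_le_of_core P (C * ρ) (fun Y => ∀ p ∈ Y, ∀ q ∈ Y, p ≠ q → 1 ≤ dist p q)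
    (fun Y S hY _ p hp q hq hpq => hY p (mem_sdiff.1 hp).1 q (mem_sdiff.1 hq).1 hpq)
    (fun Y hY hPY hcY => h ν hν ρ hρ Y P hY hPY hP hcY) X hX hPX

/-- **The atom in slab form (film above the cut) follows from its restriction to cores** (same
`R`, `C`; registered by name on stmt-Ventures-19144). -/
theorem adhesion_of_core_slab
    (h : ∃ R C : ℝ, 1 ≤ R ∧ ∀ ν : EuclideanSpace ℝ (Fin 3), ‖ν‖ = 1 → ∀ ρ : ℝ, R ≤ ρ →
      ∀ X P : Finset (EuclideanSpace ℝ (Fin 3)),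
      (∀ p ∈ X, ∀ q ∈ X, p ≠ q → 1 ≤ dist p q) → P ⊆ X →
      (∀ p, p ∈ P ↔ (p ∈ fccStacking 1 (Real.sqrt (2 / 3)) ∧ -(2 * R) ≤ ⟪p, ν⟫_ℝ ∧
        ⟪p, ν⟫_ℝ ≤ -R ∧ ‖p‖ ^ 2 - ⟪p, ν⟫_ℝ ^ 2 ≤ ρ ^ 2)) →
      (∀ q ∈ X \ P, -R < ⟪q, ν⟫_ℝ) →
      (∀ S, S ⊆ X \ P → S.Nonempty →
        contactDeficiency S < (((((X \ S) ×ˢ S).filter fun pq => dist pq.1 pq.2 = 1).card : ℕ) : ℝ)) →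
      ((((P ×ˢ (X \ P)).filter fun pq => dist pq.1 pq.2 = 1).card : ℕ) : ℝ) ≤
        contactDeficiency (X \ P) + C * ρ) :
    ∃ R C : ℝ, 1 ≤ R ∧ ∀ ν : EuclideanSpace ℝ (Fin 3), ‖ν‖ = 1 → ∀ ρ : ℝ, R ≤ ρ →
      ∀ X P : Finset (EuclideanSpace ℝ (Fin 3)),
      (∀ p ∈ X, ∀ q ∈ X, p ≠ q → 1 ≤ dist p q) → P ⊆ X →
      (∀ p, p ∈ P ↔ (p ∈ fccStacking 1 (Real.sqrt (2 / 3)) ∧ -(2 * R) ≤ ⟪p, ν⟫_ℝ ∧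
        ⟪p, ν⟫_ℝ ≤ -R ∧ ‖p‖ ^ 2 - ⟪p, ν⟫_ℝ ^ 2 ≤ ρ ^ 2)) →
      (∀ q ∈ X \ P, -R < ⟪q, ν⟫_ℝ) →
      ((((P ×ˢ (X \ P)).filter fun pq => dist pq.1 pq.2 = 1).card : ℕ) : ℝ) ≤
        contactDeficiency (X \ P) + C * ρ := by
  classical
  obtain ⟨R, C, hR, h⟩ := h
  refine ⟨R, C, hR, ?_⟩
  intro ν hν ρ hρ X P hX hPX hP habove
  refine cross_le_of_core P (C * ρ)
    (fun Y => (∀ p ∈ Y, ∀ q ∈ Y, p ≠ q → 1 ≤ dist p q) ∧ ∀ q ∈ Y \ P, -R < ⟪q, ν⟫_ℝ)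
    (fun Y S hY _ => ⟨fun p hp q hq hpq => hY.1 p (mem_sdiff.1 hp).1 q (mem_sdiff.1 hq).1 hpq,
      fun q hq => hY.2 q (mem_sdiff.2 ⟨(mem_sdiff.1 (mem_sdiff.1 hq).1).1, (mem_sdiff.1 hq).2⟩)⟩)
    (fun Y hY hPY hcY => h ν hν ρ hρ Y P hY.1 hPY hP hY.2 hcY) X ⟨hX, habove⟩ hPX

/-- **The atom follows from its restriction to 7-cores** — films every ball of which has at least
seven contacts (same `R`, `C`; registered by name on stmt-Ventures-19144). -/
theorem adhesion_of_sevenCore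
    (h : ∃ R C : ℝ, 1 ≤ R ∧ ∀ ν : EuclideanSpace ℝ (Fin 3), ‖ν‖ = 1 → ∀ ρ : ℝ, R ≤ ρ →
      ∀ X P : Finset (EuclideanSpace ℝ (Fin 3)),
      (∀ p ∈ X, ∀ q ∈ X, p ≠ q → 1 ≤ dist p q) → P ⊆ X →
      (∀ p, p ∈ P ↔ (p ∈ fccStacking 1 (Real.sqrt (2 / 3)) ∧ -(2 * R) ≤ ⟪p, ν⟫_ℝ ∧
        ⟪p, ν⟫_ℝ ≤ -R ∧ ‖p‖ ^ 2 - ⟪p, ν⟫_ℝ ^ 2 ≤ ρ ^ 2)) →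
      (∀ q ∈ X \ P, 7 ≤ (X.filter fun x => dist q x = 1).card) →
      ((((P ×ˢ (X \ P)).filter fun pq => dist pq.1 pq.2 = 1).card : ℕ) : ℝ) ≤
        contactDeficiency (X \ P) + C * ρ) :
    ∃ R C : ℝ, 1 ≤ R ∧ ∀ ν : EuclideanSpace ℝ (Fin 3), ‖ν‖ = 1 → ∀ ρ : ℝ, R ≤ ρ →
      ∀ X P : Finset (EuclideanSpace ℝ (Fin 3)),
      (∀ p ∈ X, ∀ q ∈ X, p ≠ q → 1 ≤ dist p q) → P ⊆ X →
      (∀ p, p ∈ P ↔ (p ∈ fccStacking 1 (Real.sqrt (2 / 3)) ∧ -(2 * R) ≤ ⟪p, ν⟫_ℝ ∧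
        ⟪p, ν⟫_ℝ ≤ -R ∧ ‖p‖ ^ 2 - ⟪p, ν⟫_ℝ ^ 2 ≤ ρ ^ 2)) →
      ((((P ×ˢ (X \ P)).filter fun pq => dist pq.1 pq.2 = 1).card : ℕ) : ℝ) ≤
        contactDeficiency (X \ P) + C * ρ := by
  classical
  obtain ⟨R, C, hR, h⟩ := h
  refine adhesion_of_core ⟨R, C, hR, ?_⟩
  intro ν hν ρ hρ X P hX hPX hP hcore
  exact h ν hν ρ hρ X P hX hPX hP (fun q hq => seven_le_card_partners_of_core X P hcore q hq)

/-- **The atom in slab form follows from its restriction to 7-cores** (same `R`, `C`; registered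
by name on stmt-Ventures-19144). -/
theorem adhesion_of_sevenCore_slab
    (h : ∃ R C : ℝ, 1 ≤ R ∧ ∀ ν : EuclideanSpace ℝ (Fin 3), ‖ν‖ = 1 → ∀ ρ : ℝ, R ≤ ρ →
      ∀ X P : Finset (EuclideanSpace ℝ (Fin 3)),
      (∀ p ∈ X, ∀ q ∈ X, p ≠ q → 1 ≤ dist p q) → P ⊆ X →
      (∀ p, p ∈ P ↔ (p ∈ fccStacking 1 (Real.sqrt (2 / 3)) ∧ -(2 * R) ≤ ⟪p, ν⟫_ℝ ∧
        ⟪p, ν⟫_ℝ ≤ -R ∧ ‖p‖ ^ 2 - ⟪p, ν⟫_ℝ ^ 2 ≤ ρ ^ 2)) →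
      (∀ q ∈ X \ P, -R < ⟪q, ν⟫_ℝ) →
      (∀ q ∈ X \ P, 7 ≤ (X.filter fun x => dist q x = 1).card) →
      ((((P ×ˢ (X \ P)).filter fun pq => dist pq.1 pq.2 = 1).card : ℕ) : ℝ) ≤
        contactDeficiency (X \ P) + C * ρ) :
    ∃ R C : ℝ, 1 ≤ R ∧ ∀ ν : EuclideanSpace ℝ (Fin 3), ‖ν‖ = 1 → ∀ ρ : ℝ, R ≤ ρ →
      ∀ X P : Finset (EuclideanSpace ℝ (Fin 3)),
      (∀ p ∈ X, ∀ q ∈ X, p ≠ q → 1 ≤ dist p q) → P ⊆ X →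
      (∀ p, p ∈ P ↔ (p ∈ fccStacking 1 (Real.sqrt (2 / 3)) ∧ -(2 * R) ≤ ⟪p, ν⟫_ℝ ∧
        ⟪p, ν⟫_ℝ ≤ -R ∧ ‖p‖ ^ 2 - ⟪p, ν⟫_ℝ ^ 2 ≤ ρ ^ 2)) →
      (∀ q ∈ X \ P, -R < ⟪q, ν⟫_ℝ) →
      ((((P ×ˢ (X \ P)).filter fun pq => dist pq.1 pq.2 = 1).card : ℕ) : ℝ) ≤
        contactDeficiency (X \ P) + C * ρ := by
  classical
  obtain ⟨R, C, hR, h⟩ := h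
  refine adhesion_of_core_slab ⟨R, C, hR, ?_⟩
  intro ν hν ρ hρ X P hX hPX hP habove hcore
  exact h ν hν ρ hρ X P hX hPX hP habove
    (fun q hq => seven_le_card_partners_of_core X P hcore q hq)

end Summit.Ventures.Crystal3D.Theorems

end
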